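import Mathlib
import Summits.AtomisticToContinuum.FouriersLaw.Theorems.ContactStieltjesMeasureContactMeasureLimitStubTruncatedConvergence
import Summits.AtomisticToContinuum.FouriersLaw.Theorems.ContactStieltjesMeasureContactMeasureLimitStubLayerCake

/-!
# The escaped contact mass is a `γ`-free constant (stub `stub_escapedMassConstant`)

Crux `ContactStieltjesMeasure.ContactMeasureLimit` (stmt-AtomisticToContinuum-15250), line `IdeatorOneSketch`
(idea `escaped-mass-stieltjes-constant`), registered analysis stub A3 of the lead skeleton
`Cruxes/ContactMeasureLimit/Lines/IdeatorOneSketch.lean`.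

Setting: contact kernel `k_γ(t) = 2t/(γ²+t²)²`; a family `F_N` of contact distribution functions (monotone, zero on
`(-∞,0]`, bounded) whose contact transforms `∫₀^∞ F_N k_γ` converge to `L(γ)` for every friction `γ > 0`, and a
monotone `G` vanishing on `(-∞,0]` such that the TRUNCATED transforms converge: `∫_(0,R] F_N k_γ → ∫_(0,R] G k_γ`
for every `R > 0` (bounded convergence along a Helly subsequence, stub A2). Conclusion (`stub_escapedMassConstant`):
`G k_γ` is integrable on `(0,∞)` and `L(γ) = e + ∫₀^∞ G k_γ` for ONE constant `e ≥ 0` — the contact mass escaped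
to `t = ∞`, independent of `γ` because `k_γ'/k_γ → 1` at infinity.

Proof: the tails `∫_(R,∞) F_N k_γ = ∫₀^∞ F_N k_γ - ∫_(0,R] F_N k_γ ≥ 0` converge (`N → ∞`) to
`τ(R,γ) := L(γ) - ∫_(0,R] G k_γ ≥ 0`; hence `∫_(0,R] G k_γ ≤ L(γ)` for all `R`, so `G k_γ ∈ L¹(0,∞)`
(`integrableOn_Ioi_of_intervalIntegral_norm_bounded`) and `τ(R,γ) → e(γ) := L(γ) - ∫₀^∞ G k_γ ≥ 0` as `R → ∞`
(`intervalIntegral_tendsto_integral_Ioi`); for `t ≥ R₀(ε,γ,γ')`, `k_γ'(t) ≤ (1+ε)k_γ(t)`, so the tails, their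
`N`-limits and their `R`-limits compare: `e(γ') ≤ (1+ε)e(γ)` for every `ε > 0`, whence `e(γ') ≤ e(γ)` and, by
symmetry, `e` is constant. Elementary real analysis over Mathlib (kernel facts reused from the landed stub files
`…StubTruncatedConvergence` / `…StubLayerCake`); no named facts.
-/

noncomputable section

namespace Summit.AtomisticToContinuum.FouriersLaw.Theorems.ContactMeasureLimit

open MeasureTheory Filter Set Topology

/-! ## The contact kernel -/

/-- A contact distribution function (monotone, zero on `(-∞,0]`) is nonnegative on `[0,∞)`. [folklore] -/
lemma escaped_nonneg_of_monotone {F : ℝ → ℝ} (hmono : Monotone F) (hzero : ∀ s : ℝ, s ≤ 0 → F s = 0)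
    {t : ℝ} (ht : 0 ≤ t) : 0 ≤ F t := by
  have h := hmono ht
  rwa [hzero 0 le_rfl] at h

/-- `F·k_γ` is integrable on `(a,∞)` (`a ≥ 0`) for a BOUNDED contact distribution function `F`. [folklore] -/
lemma escaped_integrableOn_mul_kernel {F : ℝ → ℝ}
    (hF : Monotone F ∧ (∀ s : ℝ, s ≤ 0 → F s = 0) ∧ ∃ m : ℝ, ∀ s : ℝ, F s ≤ m) {γ : ℝ} (hγ : 0 < γ)
    {a : ℝ} (ha : 0 ≤ a) :
    IntegrableOn (fun t : ℝ => F t * (2 * t / (γ ^ 2 + t ^ 2) ^ 2)) (Ioi a) := by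
  obtain ⟨hmono, hzero, m, hm⟩ := hF
  have hint := (layerCake_integral_Ioi_kernel hγ ha).1
  refine Integrable.mono' (hint.const_mul m) ?_ ?_
  · exact (hmono.measurable.mul (by fun_prop)).aestronglyMeasurable
  · rw [ae_restrict_iff' measurableSet_Ioi]
    refine ae_of_all _ (fun t ht => ?_)
    have ht0 : 0 ≤ t := ha.trans (le_of_lt ht)
    rw [Real.norm_eq_abs, abs_of_nonneg (mul_nonneg (escaped_nonneg_of_monotone hmono hzero ht0)
      (truncated_kernel_nonneg γ ht0))]
    exact mul_le_mul_of_nonneg_right (hm t) (truncated_kernel_nonneg γ ht0)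

/-- `G·k_γ` is integrable on every window `(0,R]` for a monotone `G` vanishing on `(-∞,0]` (it is measurable and
bounded by `G(R)·2R/γ⁴` there). [folklore] -/
lemma escaped_integrableOn_Ioc {G : ℝ → ℝ} (hG : Monotone G) (hG0 : ∀ s : ℝ, s ≤ 0 → G s = 0)
    {γ : ℝ} (hγ : 0 < γ) (R : ℝ) :
    IntegrableOn (fun t : ℝ => G t * (2 * t / (γ ^ 2 + t ^ 2) ^ 2)) (Ioc 0 R) := by
  have hγ4 : 0 < (γ ^ 2) ^ 2 := by positivity
  have hmeas : AEStronglyMeasurable (fun t : ℝ => G t * (2 * t / (γ ^ 2 + t ^ 2) ^ 2))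
      (volume.restrict (Ioc 0 R)) :=
    (hG.measurable.mul (by fun_prop)).aestronglyMeasurable
  have hconst : IntegrableOn (fun _ : ℝ => |G R| * (2 * |R| / (γ ^ 2) ^ 2)) (Ioc 0 R) :=
    integrableOn_const (by simp [Real.volume_Ioc])
  refine Integrable.mono' hconst hmeas ?_
  rw [ae_restrict_iff' measurableSet_Ioc]
  refine ae_of_all _ (fun t ht => ?_)
  have ht0 : 0 ≤ t := le_of_lt ht.1
  have hGt : 0 ≤ G t := escaped_nonneg_of_monotone hG hG0 ht0
  have hk : 0 ≤ 2 * t / (γ ^ 2 + t ^ 2) ^ 2 := truncated_kernel_nonneg γ ht0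
  rw [Real.norm_eq_abs, abs_of_nonneg (mul_nonneg hGt hk)]
  have h1 : G t ≤ |G R| := (hG ht.2).trans (le_abs_self _)
  have h2 : 2 * t / (γ ^ 2 + t ^ 2) ^ 2 ≤ 2 * |R| / (γ ^ 2) ^ 2 := by
    have hden : (γ ^ 2) ^ 2 ≤ (γ ^ 2 + t ^ 2) ^ 2 :=
      pow_le_pow_left₀ (by positivity) (by nlinarith [sq_nonneg t]) 2
    calc 2 * t / (γ ^ 2 + t ^ 2) ^ 2 ≤ 2 * t / (γ ^ 2) ^ 2 :=
          div_le_div_of_nonneg_left (by linarith) hγ4 hden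
      _ ≤ 2 * |R| / (γ ^ 2) ^ 2 := by
          gcongr
          exact ht.2.trans (le_abs_self R)
  exact mul_le_mul h1 h2 hk (abs_nonneg _)

/-- **Kernel ratio.** For frictions `γ, γ' > 0` and `ε > 0` there is `R₀ > 0` with `k_γ'(t) ≤ (1+ε)·k_γ(t)` for all
`t ≥ R₀` — because `k_γ'(t)/k_γ(t) = ((γ²+t²)/(γ'²+t²))² → 1`. [folklore] -/
lemma escaped_kernel_ratio {γ γ' ε : ℝ} (hγ : 0 < γ) (hγ' : 0 < γ') (hε : 0 < ε) :
    ∃ R₀ : ℝ, 0 < R₀ ∧ ∀ t : ℝ, R₀ ≤ t →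
      2 * t / (γ' ^ 2 + t ^ 2) ^ 2 ≤ (1 + ε) * (2 * t / (γ ^ 2 + t ^ 2) ^ 2) := by
  have h1 : Tendsto (fun t : ℝ => (γ ^ 2 - γ' ^ 2) / (γ' ^ 2 + t ^ 2)) atTop (𝓝 0) := by
    refine Tendsto.div_atTop tendsto_const_nhds ?_
    exact tendsto_atTop_add_const_left _ _ (tendsto_pow_atTop two_ne_zero)
  have h2 : Tendsto (fun t : ℝ => ((γ ^ 2 + t ^ 2) / (γ' ^ 2 + t ^ 2)) ^ 2) atTop (𝓝 1) := by
    have h : Tendsto (fun t : ℝ => 1 + (γ ^ 2 - γ' ^ 2) / (γ' ^ 2 + t ^ 2)) atTop (𝓝 (1 + 0)) :=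
      tendsto_const_nhds.add h1
    rw [add_zero] at h
    have h' : Tendsto (fun t : ℝ => (1 + (γ ^ 2 - γ' ^ 2) / (γ' ^ 2 + t ^ 2)) ^ 2) atTop
        (𝓝 ((1 : ℝ) ^ 2)) := h.pow 2
    rw [one_pow] at h'
    refine h'.congr' ?_
    filter_upwards [eventually_gt_atTop 0] with t ht
    have hpos : (γ' ^ 2 + t ^ 2) ≠ 0 := by positivity
    congr 1
    field_simp
    ring
  have h3 : ∀ᶠ t in atTop, ((γ ^ 2 + t ^ 2) / (γ' ^ 2 + t ^ 2)) ^ 2 < 1 + ε :=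
    h2.eventually (gt_mem_nhds (by linarith))
  obtain ⟨R₁, hR₁⟩ := eventually_atTop.1 h3
  refine ⟨max R₁ 1, lt_of_lt_of_le one_pos (le_max_right _ _), fun t ht => ?_⟩
  have ht1 : R₁ ≤ t := (le_max_left _ _).trans ht
  have htpos : 0 < t := lt_of_lt_of_le one_pos ((le_max_right _ _).trans ht)
  have hr := (hR₁ t ht1).le
  have hpos : (γ ^ 2 + t ^ 2) ≠ 0 := by positivity
  have hpos' : (γ' ^ 2 + t ^ 2) ≠ 0 := by positivity
  have hid : 2 * t / (γ' ^ 2 + t ^ 2) ^ 2 =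
      (2 * t / (γ ^ 2 + t ^ 2) ^ 2) * ((γ ^ 2 + t ^ 2) / (γ' ^ 2 + t ^ 2)) ^ 2 := by
    field_simp
  rw [hid, mul_comm (1 + ε)]
  exact mul_le_mul_of_nonneg_left hr (truncated_kernel_nonneg γ htpos.le)

/-! ## The stub -/

/-- **Stub A3 `stub_escapedMassConstant` (line `IdeatorOneSketch`, crux stmt-AtomisticToContinuum-15250): the
escaped contact mass is a `γ`-free constant.** If the full contact transforms `∫₀^∞ F_N k_γ` of a family of
bounded contact distribution functions converge to `L(γ)` for every `γ > 0`, and the truncated ones converge to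
`∫_(0,R] G k_γ` for every `R > 0` (`G` monotone, zero on `(-∞,0]`), then `G k_γ` is integrable on `(0,∞)` and
`L(γ) = e + ∫₀^∞ G k_γ` with ONE constant `e ≥ 0`. [folklore] -/
theorem stub_escapedMassConstant :
    ∀ (F : ℕ → ℝ → ℝ) (G : ℝ → ℝ) (L : ℝ → ℝ),
      (∀ N : ℕ, Monotone (F N) ∧ (∀ s : ℝ, s ≤ 0 → F N s = 0) ∧ ∃ m : ℝ, ∀ s : ℝ, F N s ≤ m) →
      Monotone G → (∀ s : ℝ, s ≤ 0 → G s = 0) →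
      (∀ γ : ℝ, 0 < γ →
        Filter.Tendsto (fun N : ℕ => ∫ t in Set.Ioi (0 : ℝ), F N t * (2 * t / (γ ^ 2 + t ^ 2) ^ 2))
          Filter.atTop (nhds (L γ))) →
      (∀ γ R : ℝ, 0 < γ → 0 < R →
        Filter.Tendsto (fun N : ℕ => ∫ t in Set.Ioc (0 : ℝ) R, F N t * (2 * t / (γ ^ 2 + t ^ 2) ^ 2))
          Filter.atTop (nhds (∫ t in Set.Ioc (0 : ℝ) R, G t * (2 * t / (γ ^ 2 + t ^ 2) ^ 2)))) →
      ∃ e : ℝ, 0 ≤ e ∧ ∀ γ : ℝ, 0 < γ →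
        MeasureTheory.IntegrableOn (fun t : ℝ => G t * (2 * t / (γ ^ 2 + t ^ 2) ^ 2)) (Set.Ioi (0 : ℝ)) ∧
          L γ = e + ∫ t in Set.Ioi (0 : ℝ), G t * (2 * t / (γ ^ 2 + t ^ 2) ^ 2) := by
  intro F G L hF hG hG0 hL htr
  have hF0 : ∀ (N : ℕ) (t : ℝ), 0 ≤ t → 0 ≤ F N t := fun N t ht =>
    escaped_nonneg_of_monotone (hF N).1 (hF N).2.1 ht
  have hGnn : ∀ t : ℝ, 0 ≤ t → 0 ≤ G t := fun t ht => escaped_nonneg_of_monotone hG hG0 ht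
  -- splitting the full transform of `F N` at `R`: total = truncated + tail
  have hsplit : ∀ γ : ℝ, 0 < γ → ∀ R : ℝ, 0 < R → ∀ N : ℕ,
      ∫ t in Ioi (0 : ℝ), F N t * (2 * t / (γ ^ 2 + t ^ 2) ^ 2) =
        (∫ t in Ioc (0 : ℝ) R, F N t * (2 * t / (γ ^ 2 + t ^ 2) ^ 2)) +
          ∫ t in Ioi R, F N t * (2 * t / (γ ^ 2 + t ^ 2) ^ 2) := by
    intro γ hγ R hR N
    have hI := escaped_integrableOn_mul_kernel (hF N) hγ le_rfl
    rw [← setIntegral_union (Ioc_disjoint_Ioi le_rfl) measurableSet_Ioi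
      (hI.mono_set Ioc_subset_Ioi_self) (hI.mono_set (Ioi_subset_Ioi hR.le)),
      Ioc_union_Ioi_eq_Ioi hR.le]
  have htail_nonneg : ∀ γ : ℝ, 0 < γ → ∀ R : ℝ, 0 < R → ∀ N : ℕ,
      0 ≤ ∫ t in Ioi R, F N t * (2 * t / (γ ^ 2 + t ^ 2) ^ 2) := by
    intro γ _ R hR N
    refine setIntegral_nonneg measurableSet_Ioi fun t ht => ?_
    have ht0 : 0 ≤ t := hR.le.trans (le_of_lt ht)
    exact mul_nonneg (hF0 N t ht0) (truncated_kernel_nonneg γ ht0)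
  -- the tails converge in `N` to `τ(R,γ) = L γ - ∫_(0,R] G k_γ`
  have htailN : ∀ γ : ℝ, 0 < γ → ∀ R : ℝ, 0 < R →
      Tendsto (fun N : ℕ => ∫ t in Ioi R, F N t * (2 * t / (γ ^ 2 + t ^ 2) ^ 2)) atTop
        (𝓝 (L γ - ∫ t in Ioc (0 : ℝ) R, G t * (2 * t / (γ ^ 2 + t ^ 2) ^ 2))) := by
    intro γ hγ R hR
    refine ((hL γ hγ).sub (htr γ R hγ hR)).congr fun N => ?_
    rw [hsplit γ hγ R hR N]
    ring
  -- hence the truncated `G`-transforms are bounded by `L γ`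
  have hIG_le : ∀ γ : ℝ, 0 < γ → ∀ R : ℝ, 0 < R →
      (∫ t in Ioc (0 : ℝ) R, G t * (2 * t / (γ ^ 2 + t ^ 2) ^ 2)) ≤ L γ := by
    intro γ hγ R hR
    have h := ge_of_tendsto' (htailN γ hγ R hR) (fun N => htail_nonneg γ hγ R hR N)
    linarith
  -- integrability of `G k_γ` on `(0,∞)`
  have hGint : ∀ γ : ℝ, 0 < γ →
      IntegrableOn (fun t : ℝ => G t * (2 * t / (γ ^ 2 + t ^ 2) ^ 2)) (Ioi (0 : ℝ)) := by
    intro γ hγ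
    refine integrableOn_Ioi_of_intervalIntegral_norm_bounded (L γ) 0 (l := atTop)
      (b := fun n : ℕ => (n : ℝ) + 1) (fun n => escaped_integrableOn_Ioc hG hG0 hγ _)
      (tendsto_atTop_add_const_right _ _ tendsto_natCast_atTop_atTop) ?_
    refine Eventually.of_forall fun n => ?_
    have hn : (0 : ℝ) ≤ (n : ℝ) + 1 := by positivity
    have hn' : (0 : ℝ) < (n : ℝ) + 1 := by positivity
    rw [intervalIntegral.integral_of_le hn]
    have heq : ∫ t in Ioc (0 : ℝ) ((n : ℝ) + 1), ‖G t * (2 * t / (γ ^ 2 + t ^ 2) ^ 2)‖ =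
        ∫ t in Ioc (0 : ℝ) ((n : ℝ) + 1), G t * (2 * t / (γ ^ 2 + t ^ 2) ^ 2) := by
      refine setIntegral_congr_fun measurableSet_Ioc fun t ht => ?_
      have ht0 : 0 ≤ t := le_of_lt ht.1
      rw [Real.norm_eq_abs, abs_of_nonneg (mul_nonneg (hGnn t ht0) (truncated_kernel_nonneg γ ht0))]
    rw [heq]
    exact hIG_le γ hγ _ hn'
  -- the truncated `G`-transforms converge to the full one as `R → ∞`
  have hIGlim : ∀ γ : ℝ, 0 < γ →
      Tendsto (fun R : ℝ => ∫ t in Ioc (0 : ℝ) R, G t * (2 * t / (γ ^ 2 + t ^ 2) ^ 2)) atTop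
        (𝓝 (∫ t in Ioi (0 : ℝ), G t * (2 * t / (γ ^ 2 + t ^ 2) ^ 2))) := by
    intro γ hγ
    have h := intervalIntegral_tendsto_integral_Ioi 0 (hGint γ hγ) tendsto_id
    refine h.congr' ?_
    filter_upwards [eventually_ge_atTop 0] with R hR
    exact intervalIntegral.integral_of_le hR
  -- the escaped mass at friction `γ`
  set e : ℝ → ℝ := fun γ => L γ - ∫ t in Ioi (0 : ℝ), G t * (2 * t / (γ ^ 2 + t ^ 2) ^ 2) with he_def
  have hτ : ∀ γ : ℝ, 0 < γ →
      Tendsto (fun R : ℝ => L γ - ∫ t in Ioc (0 : ℝ) R, G t * (2 * t / (γ ^ 2 + t ^ 2) ^ 2)) atTop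
        (𝓝 (e γ)) := fun γ hγ => tendsto_const_nhds.sub (hIGlim γ hγ)
  have he_nonneg : ∀ γ : ℝ, 0 < γ → 0 ≤ e γ := by
    intro γ hγ
    refine ge_of_tendsto (hτ γ hγ) ?_
    filter_upwards [eventually_gt_atTop 0] with R hR
    linarith [hIG_le γ hγ R hR]
  -- comparison of escaped masses at two frictions
  have hcmp : ∀ γ γ' : ℝ, 0 < γ → 0 < γ' → e γ' ≤ e γ := by
    intro γ γ' hγ hγ'
    refine le_of_forall_pos_le_add fun ε' hε' => ?_
    have heγ := he_nonneg γ hγ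
    set ε : ℝ := ε' / (e γ + 1) with hε_def
    have hε : 0 < ε := div_pos hε' (by linarith)
    obtain ⟨R₀, hR₀, hratio⟩ := escaped_kernel_ratio hγ hγ' hε
    -- tails compare for `R ≥ R₀`
    have htailcmp : ∀ R : ℝ, R₀ ≤ R → ∀ N : ℕ,
        ∫ t in Ioi R, F N t * (2 * t / (γ' ^ 2 + t ^ 2) ^ 2) ≤
          (1 + ε) * ∫ t in Ioi R, F N t * (2 * t / (γ ^ 2 + t ^ 2) ^ 2) := by
      intro R hR N
      have hRnn : 0 ≤ R := hR₀.le.trans hR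
      rw [← integral_const_mul]
      refine setIntegral_mono_on (escaped_integrableOn_mul_kernel (hF N) hγ' hRnn)
        ((escaped_integrableOn_mul_kernel (hF N) hγ hRnn).const_mul _) measurableSet_Ioi
        fun t ht => ?_
      have hk := hratio t (hR.trans (le_of_lt ht))
      calc F N t * (2 * t / (γ' ^ 2 + t ^ 2) ^ 2)
          ≤ F N t * ((1 + ε) * (2 * t / (γ ^ 2 + t ^ 2) ^ 2)) :=
            mul_le_mul_of_nonneg_left hk (hF0 N t (hRnn.trans (le_of_lt ht)))
        _ = (1 + ε) * (F N t * (2 * t / (γ ^ 2 + t ^ 2) ^ 2)) := by ring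
    -- `N → ∞`: the tail limits compare
    have hτcmp : ∀ R : ℝ, R₀ ≤ R →
        L γ' - ∫ t in Ioc (0 : ℝ) R, G t * (2 * t / (γ' ^ 2 + t ^ 2) ^ 2) ≤
          (1 + ε) * (L γ - ∫ t in Ioc (0 : ℝ) R, G t * (2 * t / (γ ^ 2 + t ^ 2) ^ 2)) := by
      intro R hR
      have hRpos : 0 < R := hR₀.trans_le hR
      exact le_of_tendsto_of_tendsto (htailN γ' hγ' R hRpos)
        ((htailN γ hγ R hRpos).const_mul (1 + ε)) (Eventually.of_forall (htailcmp R hR))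
    -- `R → ∞`: the escaped masses compare
    have hle : e γ' ≤ (1 + ε) * e γ := by
      refine le_of_tendsto_of_tendsto (hτ γ' hγ') ((hτ γ hγ).const_mul (1 + ε)) ?_
      filter_upwards [eventually_ge_atTop R₀] with R hR
      exact hτcmp R hR
    have hεe : ε * e γ ≤ ε' := by
      rw [hε_def, div_mul_eq_mul_div, div_le_iff₀ (by linarith)]
      nlinarith
    linarith
  have hconst : ∀ γ : ℝ, 0 < γ → e γ = e 1 := fun γ hγ =>
    le_antisymm (hcmp 1 γ one_pos hγ) (hcmp γ 1 hγ one_pos)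
  refine ⟨e 1, he_nonneg 1 one_pos, fun γ hγ => ⟨hGint γ hγ, ?_⟩⟩
  rw [← hconst γ hγ, he_def]
  ring

end Summit.AtomisticToContinuum.FouriersLaw.Theorems.ContactMeasureLimit

end
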